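import Summits.PneNP.PneNP.Theorems.LatticeMagicTargetStubGameMachine
import Literature.Computability.Cryptography.CryptoFoundationsOneWayFunctionsGLProofs

/-!
# FIRST LEMMA of line `SketchIdeator5` (crux `Target`, stmt-PneNP-10709): one-way + hard-core ⟹
# the hard-bit vector game is hard for `FP` students with `O(1)` rounds (`stub_game`)

Card `kpt-squeeze-ideal-lattice-leg`, §First lemma. Given a one-way `g` with hard-core predicate
`B`, no polynomial-time student wins the Student–Teacher hard-bit vector game on `t = 2k+2` hidden
`n`-bit strings within `k` rounds against every legal teacher, for all large `n`.

**Proof (a PPT reduction in the tree's `RandAlg` model).** Suppose `S ∈ FP` wins within `k` rounds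
on every instance of `2k+2` strings of every large length `n` against every legal teacher. For each
planted coordinate `j₀ < t` let `A_{j₀}` be the predictor that on `⟨1ⁿ, g x⟩` reads `t` blocks
`u_0, …, u_{t-1}` of `n` coins, forms the instance `I` with `u_{j₀}` replaced by the (unknown) `x`
(it knows the images: `g x` is its input), and plays `S` for `k` rounds against the simulated
teacher "reveal the lowest wrong coordinate `≠ j₀`" (computable: it knows `u_j` and `B (u_j)` for
`j ≠ j₀`), answering with `S`'s bit at `j₀` the first time all coordinates `≠ j₀` are right. Against
the real teacher "reveal the lowest wrong coordinate" `S` wins at some round `r < k` on `I`; if `j₀`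
is not among the `≤ k - 1` coordinates revealed before round `r`, the simulated play coincides with
the real one up to round `r` and `A_{j₀}` answers `B x`. As `(x, u_{-j₀})` is a uniform instance,
`∑_{j₀} Pr[A_{j₀} = B x] ≥ t - (k - 1) = k + 3 = t/2 + 2` for all large `n`, whereas hard-coreness
of `B` forces `∑_{j₀} (Pr[A_{j₀} = B x] - 1/2) → 0`. Each `A_{j₀}` is PPT: its run function is a
composite of the tree's `FP` bricks (`BrickAlgebra.lean`, `PlumbingBricks.lean`) around `k` calls of
`S`, `t` calls of `g` and `B`; the coin budget is `t ℓ` on inputs of length `ℓ`.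

## References

* J. Krajíček, arXiv:2506.20221, §2 (the Student–Teacher game behind Hypothesis (ST)).
* O. Goldreich, *Foundations of Cryptography I*, CUP 2001, Def. 2.5.1 (hard-core predicates),
  §2.5.2 (reductions run the adversary as a subroutine).
* S. Arora, B. Barak, *Computational Complexity: A Modern Approach*, CUP 2009, §1.3, §7.1.
-/

set_option linter.dupNamespace false -- `Summit.PneNP.PneNP` is the mandated summit-side namespace

namespace Summit.PneNP.PneNP.Theorems.LatticeMagicTarget

open Literature.Computability.Complexity Literature.Computability.Cryptography
open _root_.Computability

namespace StubGame

variable {t : ℕ} (g : List Bool → List Bool) (B : List Bool → Bool) (S : List Bool → List Bool)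

/-! ### 5. Counting: the predictors' total success is at least `k + 3` -/

section Counting

open Finset

variable {g B S} {Bb : List Bool → List Bool}

/-- The instance with blocks `yv` and the challenge preimage `x` planted at `j₀`. -/
def instY (j₀ : Fin t) (x : List Bool) {n : ℕ} (yv : Fin t → List.Vector Bool n) : HBInstance t :=
  ⟨fun j => if j = j₀ then x else (yv j).toList⟩

/-- The instance with blocks `yv`. -/
def instV {n : ℕ} (yv : Fin t → List.Vector Bool n) : HBInstance t := ⟨fun j => (yv j).toList⟩

/-- The instance assembled from a coin vector is the planted instance of its blocks. -/
theorem inst_eq_instY (j₀ : Fin t) (x : List Bool) {n C : ℕ} (hC : n * t ≤ C) (v : List.Vector Bool C) :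
    inst t j₀ x v.toList n = instY j₀ x (chunks n t hC v) := rfl

/-- Updating an inserted tuple at the insertion point. -/
theorem update_insertNth {m : ℕ} {α : Type} (j₀ : Fin (m + 1)) (a b : α) (f : Fin m → α) :
    Function.update (Fin.insertNth (α := fun _ => α) j₀ a f) j₀ b =
      Fin.insertNth (α := fun _ => α) j₀ b f := by
  funext j
  rcases Fin.eq_self_or_eq_succAbove j₀ j with rfl | ⟨i, rfl⟩
  · simp
  · rw [Function.update_of_ne (Fin.succAbove_ne j₀ i), Fin.insertNth_apply_succAbove,
      Fin.insertNth_apply_succAbove]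

/-- Planting `x` at `j₀` into the blocks `yv` is updating the block family. -/
theorem instY_update {m n : ℕ} (j₀ : Fin (m + 1)) (x : List.Vector Bool n)
    (yv : Fin (m + 1) → List.Vector Bool n) :
    instV (Function.update yv j₀ x) = instY j₀ x.toList yv := by
  unfold instV instY
  congr 1
  funext j
  rw [Function.update_apply]
  split_ifs <;> rfl

/-- **Planting is free**: summing over the challenge `x` and the blocks `yv` a function of the
instance with `x` planted at `j₀` is `2ⁿ` times its sum over all block families. -/
theorem sum_sum_update {m n : ℕ} (j₀ : Fin (m + 1)) (F : (Fin (m + 1) → List.Vector Bool n) → ℝ) :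
    ∑ x : List.Vector Bool n, ∑ yv : Fin (m + 1) → List.Vector Bool n, F (Function.update yv j₀ x) =
      2 ^ n * ∑ yv : Fin (m + 1) → List.Vector Bool n, F yv := by
  have h1 : ∀ x : List.Vector Bool n,
      ∑ yv : Fin (m + 1) → List.Vector Bool n, F (Function.update yv j₀ x) =
        ∑ p : List.Vector Bool n × (Fin m → List.Vector Bool n),
          F (Fin.insertNth (α := fun _ => List.Vector Bool n) j₀ x p.2) := by
    intro x
    rw [← Fintype.sum_equiv (Fin.insertNthEquiv (fun _ => List.Vector Bool n) j₀)
      (fun p => F (Function.update (Fin.insertNth (α := fun _ => List.Vector Bool n) j₀ p.1 p.2) j₀ x))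
      (fun yv => F (Function.update yv j₀ x)) (fun p => rfl)]
    simp only [update_insertNth]
  have h2 : ∑ yv : Fin (m + 1) → List.Vector Bool n, F yv =
      ∑ p : List.Vector Bool n × (Fin m → List.Vector Bool n),
        F (Fin.insertNth (α := fun _ => List.Vector Bool n) j₀ p.1 p.2) :=
    (Fintype.sum_equiv (Fin.insertNthEquiv (fun _ => List.Vector Bool n) j₀) _ _ fun p => rfl).symm
  calc ∑ x : List.Vector Bool n, ∑ yv : Fin (m + 1) → List.Vector Bool n, F (Function.update yv j₀ x)
      = ∑ x : List.Vector Bool n, ∑ p : List.Vector Bool n × (Fin m → List.Vector Bool n),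
          F (Fin.insertNth (α := fun _ => List.Vector Bool n) j₀ x p.2) := by simp_rw [h1]
    _ = ∑ x : List.Vector Bool n, ∑ _a : List.Vector Bool n, ∑ f : Fin m → List.Vector Bool n,
          F (Fin.insertNth (α := fun _ => List.Vector Bool n) j₀ x f) := by
        simp_rw [Fintype.sum_prod_type]
    _ = ∑ x : List.Vector Bool n, (2 : ℝ) ^ n * ∑ f : Fin m → List.Vector Bool n,
          F (Fin.insertNth (α := fun _ => List.Vector Bool n) j₀ x f) := by
        simp only [Finset.sum_const, Finset.card_univ, card_vector, Fintype.card_bool, nsmul_eq_mul,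
          Nat.cast_pow, Nat.cast_ofNat]
    _ = 2 ^ n * ∑ p : List.Vector Bool n × (Fin m → List.Vector Bool n),
          F (Fin.insertNth (α := fun _ => List.Vector Bool n) j₀ p.1 p.2) := by
        rw [← Finset.mul_sum, Fintype.sum_prod_type]
    _ = 2 ^ n * ∑ yv : Fin (m + 1) → List.Vector Bool n, F yv := by rw [← h2]

/-- **Pointwise comparison**: the success probability of `A_{j₀}` on `⟨1ⁿ, g x⟩` is at least the
probability, over the blocks, that `j₀` is good for the planted instance. -/
theorem pr_adv_ge (hBb : ∀ w, Bb w = [B w]) (k : ℕ) {j₀ d d₀ : Fin t} (hd : d ≠ j₀) (n : ℕ)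
    (x : List Bool) :
    (∑ yv : Fin t → List.Vector Bool n,
        if j₀ ∈ goodSet g B S k (instY j₀ x yv) d₀ then (1 : ℝ) else 0) / 2 ^ (n * t) ≤
      (adv g S Bb k t j₀ d).pr id (boolPair (unaryEncodeNat n) (g x)) {B x} := by
  classical
  set inp := boolPair (unaryEncodeNat n) (g x) with hinp
  have hL : (adv g S Bb k t j₀ d).coinLen (id inp).length = t * inp.length := rfl
  have hC : n * t ≤ t * inp.length := by
    rw [mul_comm]
    refine Nat.mul_le_mul_left t ?_
    simp only [hinp, length_boolPair, show ∀ m : ℕ, (unaryEncodeNat m).length = m from unary_decode_encode_nat]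
    omega
  rw [GLFunOW.pr_eq_card (adv g S Bb k t j₀ d) id inp {B x} hL]
  have hsub : ∀ v : List.Vector Bool (t * inp.length),
      j₀ ∈ goodSet g B S k (instY j₀ x (chunks n t hC v)) d₀ →
        (adv g S Bb k t j₀ d).run inp v.toList ∈ ({B x} : Set Bool) := by
    intro v hgood
    rw [Set.mem_singleton_iff]
    change (adv g S Bb k t j₀ d).run (boolPair (unaryEncodeNat n) (g x)) v.toList = B x
    rw [run_eq_simAnswer hBb k hd x v.toList n, inst_eq_instY j₀ x hC v,
      simAnswer_eq_of_good g B S hgood]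
    simp [instY]
  have h2 : (2 : ℝ) ^ (t * inp.length) = 2 ^ (t * inp.length - n * t) * 2 ^ (n * t) := by
    rw [← pow_add, Nat.sub_add_cancel hC]
  have key : (∑ yv : Fin t → List.Vector Bool n,
        if j₀ ∈ goodSet g B S k (instY j₀ x yv) d₀ then (1 : ℝ) else 0) / 2 ^ (n * t) =
      ((univ.filter fun v : List.Vector Bool (t * inp.length) =>
          j₀ ∈ goodSet g B S k (instY j₀ x (chunks n t hC v)) d₀).card : ℝ) / 2 ^ (t * inp.length) := by
    rw [natCast_card_filter, sum_vector_chunks n t hC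
      (fun yv => if j₀ ∈ goodSet g B S k (instY j₀ x yv) d₀ then (1 : ℝ) else 0), nsmul_eq_mul, h2]
    push_cast
    rw [mul_div_mul_left _ _ (by positivity)]
  rw [key]
  refine div_le_div_of_nonneg_right ?_ (by positivity)
  exact_mod_cast card_le_card fun v hv => by
    simp only [mem_filter, mem_univ, true_and] at hv ⊢
    exact hsub v hv

/-- The fixed default coordinate of the real teacher. -/
def dReal (k : ℕ) : Fin (2 * k + 2) := ⟨0, by omega⟩

/-- The default coordinate of the simulated teacher (any coordinate other than `j₀`). -/
def dSim (k : ℕ) (j₀ : Fin (2 * k + 2)) : Fin (2 * k + 2) :=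
  if (j₀ : ℕ) = 0 then ⟨1, by omega⟩ else ⟨0, by omega⟩

/-- The simulated teacher's default is not the planted coordinate. -/
theorem dSim_ne (k : ℕ) (j₀ : Fin (2 * k + 2)) : dSim k j₀ ≠ j₀ := by
  unfold dSim
  split_ifs with h
  · intro he
    have := congrArg Fin.val he
    simp only at this
    omega
  · intro he
    exact h (congrArg Fin.val he).symm

/-- **At most `k - 1` planted coordinates are bad.** If `S` wins against the real teacher within
`k` rounds, then all but at most `k - 1` of the `2k + 2` coordinates are good. -/
theorem card_goodSet_ge (k : ℕ) (I : HBInstance (2 * k + 2)) (hwin : HBWins g B S (realT B I (dReal k)) I k) :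
    ((k : ℝ) + 3) ≤ (goodSet g B S k I (dReal k)).card := by
  classical
  obtain ⟨r, hrk, hr⟩ := hwin
  have hex : ∃ r, r < k ∧ ∀ j, ¬ Wrong B I (hbProposal g S (realT B I (dReal k)) I r) j := ⟨r, hrk, hr⟩
  have hr₀k : Nat.find hex < k := (Nat.find_spec hex).1
  have hr₀win := (Nat.find_spec hex).2
  have hbefore : ∀ r' < Nat.find hex, ∃ j, Wrong B I (hbProposal g S (realT B I (dReal k)) I r') j := by
    intro r' hr'
    have h := Nat.find_min hex hr'
    by_contra hne
    push Not at hne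
    exact h ⟨lt_trans hr' hr₀k, hne⟩
  set bad : Finset (Fin (2 * k + 2)) := (Finset.range (Nat.find hex)).image fun r' =>
    realT B I (dReal k) (hbProposal g S (realT B I (dReal k)) I r')
      (hbHist g S (realT B I (dReal k)) I r') with hbad
  have hgood : ∀ j₀, j₀ ∉ bad → j₀ ∈ goodSet g B S k I (dReal k) := by
    intro j₀ hj₀
    refine (mem_goodSet g B S).2 ⟨Nat.find hex, hr₀k, hr₀win, fun r' hr' => ⟨hbefore r' hr', fun heq => hj₀ ?_⟩⟩
    exact Finset.mem_image.2 ⟨r', Finset.mem_range.2 hr', heq⟩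
  have hcard : bad.card ≤ Nat.find hex := Finset.card_image_le.trans (by simp)
  calc ((k : ℝ) + 3) ≤ ((univ \ bad).card : ℝ) := by
        rw [Finset.card_univ_sdiff, Fintype.card_fin]
        have : k + 3 ≤ 2 * k + 2 - bad.card := by omega
        exact_mod_cast this
    _ ≤ ((goodSet g B S k I (dReal k)).card : ℝ) := by
        exact_mod_cast card_le_card fun j₀ hj₀ => hgood j₀ (Finset.mem_sdiff.1 hj₀).2

/-- **The total success of the `2k + 2` predictors is at least `k + 3`** at every length `n` at
which `S` wins on all instances against all legal teachers. -/
theorem sum_pr_ge (hBb : ∀ w, Bb w = [B w]) (k n : ℕ)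
    (hwin : ∀ I : HBInstance (2 * k + 2), (∀ j, (I.u j).length = n) →
      ∀ T, HBLegal g B S T I k → HBWins g B S T I k) :
    ((k : ℝ) + 3) ≤ ∑ j₀ : Fin (2 * k + 2), uniformAvg n fun x =>
      (adv g S Bb k (2 * k + 2) j₀ (dSim k j₀)).pr id (boolPair (unaryEncodeNat n) (g x)) {B x} := by
  classical
  -- per planted coordinate: the average success dominates the frequency of the good event
  have h1 : ∀ j₀ : Fin (2 * k + 2),
      (∑ yv : Fin (2 * k + 2) → List.Vector Bool n,
          if j₀ ∈ goodSet g B S k (instV yv) (dReal k) then (1 : ℝ) else 0) / 2 ^ (n * (2 * k + 2)) ≤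
        uniformAvg n fun x =>
          (adv g S Bb k (2 * k + 2) j₀ (dSim k j₀)).pr id (boolPair (unaryEncodeNat n) (g x)) {B x} := by
    intro j₀
    unfold uniformAvg
    rw [le_div_iff₀ (by positivity), div_mul_eq_mul_div, mul_comm, ← sum_sum_update j₀]
    rw [Finset.sum_div]
    refine Finset.sum_le_sum fun x _ => ?_
    simp_rw [instY_update]
    exact pr_adv_ge hBb k (dSim_ne k j₀) n x.toList
  -- the indicator sum over `j₀` is the number of good coordinates
  have h2 : ∀ yv : Fin (2 * k + 2) → List.Vector Bool n,
      ∑ j₀ : Fin (2 * k + 2), (if j₀ ∈ goodSet g B S k (instV yv) (dReal k) then (1 : ℝ) else 0) =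
        (goodSet g B S k (instV yv) (dReal k)).card := by
    intro yv
    rw [Finset.sum_boole, Finset.filter_mem_eq_inter, Finset.univ_inter]
  -- sum over the planted coordinate and exchange the sums
  have hcardR : ((Fintype.card (Fin (2 * k + 2) → List.Vector Bool n) : ℕ) : ℝ) = 2 ^ (n * (2 * k + 2)) := by
    rw [Fintype.card_fun, card_vector, Fintype.card_bool, Fintype.card_fin, ← pow_mul]
    push_cast
    ring
  calc ((k : ℝ) + 3)
      = (∑ _yv : Fin (2 * k + 2) → List.Vector Bool n, ((k : ℝ) + 3)) / 2 ^ (n * (2 * k + 2)) := by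
        rw [Finset.sum_const, Finset.card_univ, nsmul_eq_mul, hcardR]
        field_simp
    _ ≤ (∑ yv : Fin (2 * k + 2) → List.Vector Bool n, ∑ j₀ : Fin (2 * k + 2),
          if j₀ ∈ goodSet g B S k (instV yv) (dReal k) then (1 : ℝ) else 0) / 2 ^ (n * (2 * k + 2)) := by
        refine div_le_div_of_nonneg_right (Finset.sum_le_sum fun yv _ => ?_) (by positivity)
        rw [h2]
        exact card_goodSet_ge k (instV yv)
          (hwin _ (fun j => (yv j).toList_length) _ (realT_legal g B S _ _ k))
    _ = ∑ j₀ : Fin (2 * k + 2), (∑ yv : Fin (2 * k + 2) → List.Vector Bool n,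
          if j₀ ∈ goodSet g B S k (instV yv) (dReal k) then (1 : ℝ) else 0) / 2 ^ (n * (2 * k + 2)) := by
        rw [Finset.sum_comm, Finset.sum_div]
    _ ≤ _ := Finset.sum_le_sum fun j₀ _ => h1 j₀

end Counting

end StubGame

/-! ### 6. The FIRST LEMMA -/

open StubGame Filter in
/-- **FIRST LEMMA** (`stub_game`; card `kpt-squeeze-ideal-lattice-leg` §First lemma). A strong
one-way function with a hard-core predicate makes the hard-bit vector game hard for p-time students
with O(1) rounds: plant the challenge at each coordinate `j₀` of `t = 2k+2`, self-sample the other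
coordinates WITH their preimages, play the teacher "reveal the lowest wrong coordinate `≠ j₀`",
output the student's bit at `j₀` the first time all coordinates `≠ j₀` are right; the `2k + 2` PPT
predictors have total success `≥ k + 3 = t/2 + 2` for all large `n`, contradicting the negligible
advantage of each of them (`IsHardCorePredicate`). Only the polynomial-time part of `IsOneWay g`
is used. -/
theorem _root_.Summit.PneNP.PneNP.Theorems.LatticeMagicTarget.stub_game (g : List Bool → List Bool)
    (B : List Bool → Bool) (hg : IsOneWay g) (hB : IsHardCorePredicate B g) : STGameHard g B := by
  intro k S hS n₀
  by_contra hcon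
  push Not at hcon
  set Bb : List Bool → List Bool := fun w => [B w] with hBb_def
  have hBb : ∀ w, Bb w = [B w] := fun w => rfl
  have hBbFP : Bb ∈ FP := by
    obtain ⟨p, M, hM⟩ := hB.1
    exact ⟨p, M, fun a => hM a⟩
  have hgFP : g ∈ FP := hg.1
  -- each predictor has negligible advantage, so the sum of the `2k+2` advantages tends to `0`
  have hdec : ∀ j₀ : Fin (2 * k + 2), Tendsto (fun n => uniformAvg n (fun x =>
      (adv g S Bb k (2 * k + 2) j₀ (dSim k j₀)).pr id (boolPair (unaryEncodeNat n) (g x)) {B x}) - 2⁻¹)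
      atTop (nhds 0) := by
    intro j₀
    have h := hB.2 (adv g S Bb k (2 * k + 2) j₀ (dSim k j₀)) (adv_isPPT hgFP hS hBbFP k _ j₀ _) 0
    simpa using h
  have hsum := tendsto_finsetSum (Finset.univ : Finset (Fin (2 * k + 2))) fun j₀ _ => hdec j₀
  rw [Finset.sum_const_zero] at hsum
  obtain ⟨N, hN⟩ := Filter.eventually_atTop.1 (hsum.eventually (gt_mem_nhds (show (0 : ℝ) < 1 by norm_num)))
  -- but at every large `n` the sum of the success probabilities is at least `k + 3`
  have hbig := sum_pr_ge (g := g) (B := B) (S := S) hBb k (max N n₀)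
    (fun I hI T hT => hcon _ (le_max_right _ _) I hI T hT)
  have hlt := hN (max N n₀) (le_max_left _ _)
  rw [Finset.sum_sub_distrib, Finset.sum_const, Finset.card_univ, Fintype.card_fin, nsmul_eq_mul] at hlt
  push_cast at hlt
  nlinarith [hbig, hlt]

end Summit.PneNP.PneNP.Theorems.LatticeMagicTarget
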